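/-
Copyright: public domain mathematics; formalisation notes by the eng-sdp-4 engines lane (shared numerical
engines serving client cells; rigour lives in the verifiers).
-/
import Literature.MathematicalPhysics.QuantumFieldTheory.ConformalBootstrap3D.DiagonalTailRatioBound
import HarnessLib

/-!
# The diagonal-series majorant in the wide parameter regime `c ≥ −5/8` (levels `n ≥ 4`)

`DiagonalTailRatioBound` proves the level-ratio bound
`κ_{n,i}(c; Δ) ≤ K_n(c; Δ) = (Δ+n+2c)²/((n+1)(2Δ+n−2))` of the scalar-exchange Dolan–Osborn recursion
(DO 2004 §3 eqs. (3.11)–(3.12)) for `c ≥ −1/2` from level `n ≥ 2` on, and from it the closed-form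
majorant of the reflection-positive diagonal series `D(c; y) = diagSeriesAB c Δ 0 y`. The block
parameter of a mixed label is `c = ∓(Δ_i − Δ_j)/2`; on dimension boxes reaching `Δ_i − Δ_j > 1`
(e.g. `Δ_s − Δ_φ` slightly above `1` at the edge of an O(2) scan window) `c` drops below `−1/2`.
This file proves the SAME bound in the wider regime
`c ≥ −5/8` from level `n ≥ 4` on — the price of the extra eighth is two more head levels — by the same
mechanism: with `F = Δ+n+2c`, `Q = (n+1)(2Δ+n−2)` one has `c ≥ −5/8 ⟺ Q ≤ (n+1)(2F−n+1/2)` and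
`Δ ≥ 1/2 ⟹ F ≥ n − 3/4`, the numerator polynomial `Φ(F, Q, i)` of `K_n − κ_{n,i}` has `Φ(F,·,i)/·`
decreasing, and `Φ(F, (n+1)(2F−n+1/2), i)` is a polynomial with non-negative coefficients in
`(F−n+3/4, i−1, n−3−i)` for `i ≤ n−3` and in `(F−n+3/4, n−4)` for `i ∈ {n−2, n−1, n}` — four finite
certificates checked by `ring` + `positivity` (`n = 3` genuinely fails at `c = −5/8`, `Δ = 1/2`, `i = 3`).

Consequences, with the definitions of `DiagonalTailRatioBound` unchanged (`diagKappa`, `diagRatioBound`,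
`DiagRatioDom`, `DiagRatioTest`, `diagBoxBound`): `a_{n+1}(c,c) ≤ K_n a_n(c,c)` for `n ≥ 4`
(`hrDiagCoeffAB_self_succ_le_wide`), the geometric tail from level `N+1 ≥ 4` (`diagTailAB_le_geom_wide`),
`D ≤ S_N + a_{N+1}y^{Δ+N+1}/(1−qy)` (`diagSeriesAB_le_head_add_geom_wide`), domination on a parameter box
from the two corner tests under the explicit sign condition `Δ₁ + N + 2c₁ ≥ 0` in place of `c₁ ≥ −1/2`
(`diagRatioDom_on_box_of_nonneg`), and ONE number per box (`diagSeriesAB_le_boxBound_wide`, `c₁ ≥ −5/8`,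
`N ≥ 3`).

NON-CLAIMS. Elementary real-algebra estimates on the Dolan–Osborn recursion for scalar exchange only
(`ℓ = 0`, `Δ > 1/2`); the regime `c ≥ −5/8`, `n ≥ 4` is a sufficient one (the true wall of the single
closed form `K_n` is `c > −3/4` with a level threshold growing as `c ↓ −3/4`); nothing is evaluated, no
table is instantiated, nothing is asserted about any model. Filed as kind `definition` only because of the
private certificate polynomial; no public definition is introduced.
-/

noncomputable section

namespace Literature.MathematicalPhysics.QuantumFieldTheory.ConformalBootstrap3D

open Finset Set

/-! ### 1. The four certificates of the wide regime -/

/-- The numerator polynomial `Φ(F, Q, x)` of `K_n − κ_{n,x}` (same polynomial as in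
`DiagonalTailRatioBound`, restated privately for the certificates of this file):
`Q·(F²(x²+x+2) + 4x(x+1)F − 2x(x+1)² − x²(x²−1) − x(x+1)Q) + F²(x−1)x(x+1)(x+2)`. [folklore] -/
private def widePhiPoly (F Q x : ℝ) : ℝ :=
  Q * (F ^ 2 * (x ^ 2 + x + 2) + 4 * x * (x + 1) * F - 2 * x * (x + 1) ^ 2 - x ^ 2 * (x ^ 2 - 1) -
      x * (x + 1) * Q) + F ^ 2 * (x - 1) * x * (x + 1) * (x + 2)

/-- Certificate A (`x ≤ n − 3`): with `x = 1 + a`, `n = 4 + a + b`, `F = n − 3/4 + f` (`f, a, b ≥ 0`),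
`Φ(F, (n+1)(2F−n+1/2), x)` has non-negative coefficients in `f, a, b`. [folklore] -/
private theorem widePhiPoly_certA {f a b : ℝ} (hf : 0 ≤ f) (ha : 0 ≤ a) (hb : 0 ≤ b) :
    0 ≤ widePhiPoly (a + b + f + 13 / 4) ((a + b + 5) * (a + b + 2 * f + 3)) (a + 1) := by
  have key : widePhiPoly (a + b + f + 13 / 4) ((a + b + 5) * (a + b + 2 * f + 3)) (a + 1) =
      (1815/4 : ℝ) + (512 : ℝ) * b + (11051/16 : ℝ) * a + (1025/2 : ℝ) * f + (817/4 : ℝ) * b ^ 2 +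
      (1243/2 : ℝ) * a * b + (3495/8 : ℝ) * a ^ 2 + (825/2 : ℝ) * f * b + (4407/8 : ℝ) * f * a +
      (200 : ℝ) * f ^ 2 + (34 : ℝ) * b ^ 3 + (2811/16 : ℝ) * a * b ^ 2 + (2455/8 : ℝ) * a ^ 2 * b +
      (2217/16 : ℝ) * a ^ 3 + (102 : ℝ) * f * b ^ 2 + (2547/8 : ℝ) * f * a * b +
      (231 : ℝ) * f * a ^ 2 + (100 : ℝ) * f ^ 2 * b + (166 : ℝ) * f ^ 2 * a + (40 : ℝ) * f ^ 3 +
      (2 : ℝ) * b ^ 4 + (31/2 : ℝ) * a * b ^ 3 + (945/16 : ℝ) * a ^ 2 * b ^ 2 +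
      (565/8 : ℝ) * a ^ 3 * b + (165/8 : ℝ) * a ^ 4 + (8 : ℝ) * f * b ^ 3 +
      (81/2 : ℝ) * f * a * b ^ 2 + (761/8 : ℝ) * f * a ^ 2 * b + (333/8 : ℝ) * f * a ^ 3 +
      (12 : ℝ) * f ^ 2 * b ^ 2 + (51 : ℝ) * f ^ 2 * a * b + (70 : ℝ) * f ^ 2 * a ^ 2 +
      (8 : ℝ) * f ^ 3 * b + (38 : ℝ) * f ^ 3 * a + (5/2 : ℝ) * a ^ 2 * b ^ 3 +
      (15/2 : ℝ) * a ^ 3 * b ^ 2 + (6 : ℝ) * a ^ 4 * b + (1 : ℝ) * a ^ 5 +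
      (11/2 : ℝ) * f * a ^ 2 * b ^ 2 + (11 : ℝ) * f * a ^ 3 * b + (2 : ℝ) * f * a ^ 4 +
      (3 : ℝ) * f ^ 2 * a * b ^ 2 + (15 : ℝ) * f ^ 2 * a ^ 2 * b + (18 : ℝ) * f ^ 2 * a ^ 3 +
      (6 : ℝ) * f ^ 3 * a * b + (16 : ℝ) * f ^ 3 * a ^ 2 + (1 : ℝ) * f ^ 2 * a ^ 2 * b ^ 2 +
      (2 : ℝ) * f ^ 2 * a ^ 3 * b + (2 : ℝ) * f ^ 2 * a ^ 4 + (2 : ℝ) * f ^ 3 * a ^ 2 * b +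
      (2 : ℝ) * f ^ 3 * a ^ 3 := by
    unfold widePhiPoly; ring
  rw [key]; positivity

/-- Certificate B0 (`x = n − 0`): with `n = 4 + a`, `F = n − 3/4 + f` (`f, a ≥ 0`),
`Φ(F, (n+1)(2F−n+1/2), n − 0)` has non-negative coefficients in `f, a`. [folklore] -/
private theorem widePhiPoly_certB0 {f a : ℝ} (hf : 0 ≤ f) (ha : 0 ≤ a) :
    0 ≤ widePhiPoly (a + f + 13 / 4) ((a + 5) * (a + 2 * f + 3)) (a + 4) := by
  have key : widePhiPoly (a + f + 13 / 4) ((a + 5) * (a + 2 * f + 3)) (a + 4) =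
      (705/8 : ℝ) + (6437/16 : ℝ) * a + (835/4 : ℝ) * f + (1359/4 : ℝ) * a ^ 2 +
      (3039/8 : ℝ) * f * a + (920 : ℝ) * f ^ 2 + (1851/16 : ℝ) * a ^ 3 + (723/4 : ℝ) * f * a ^ 2 +
      (784 : ℝ) * f ^ 2 * a + (220 : ℝ) * f ^ 3 + (141/8 : ℝ) * a ^ 4 + (261/8 : ℝ) * f * a ^ 3 +
      (250 : ℝ) * f ^ 2 * a ^ 2 + (134 : ℝ) * f ^ 3 * a + (1 : ℝ) * a ^ 5 + (2 : ℝ) * f * a ^ 4 +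
      (36 : ℝ) * f ^ 2 * a ^ 3 + (28 : ℝ) * f ^ 3 * a ^ 2 + (2 : ℝ) * f ^ 2 * a ^ 4 +
      (2 : ℝ) * f ^ 3 * a ^ 3 := by
    unfold widePhiPoly; ring
  rw [key]; positivity

/-- Certificate B1 (`x = n − 1`): with `n = 4 + a`, `F = n − 3/4 + f` (`f, a ≥ 0`),
`Φ(F, (n+1)(2F−n+1/2), n − 1)` has non-negative coefficients in `f, a`. [folklore] -/
private theorem widePhiPoly_certB1 {f a : ℝ} (hf : 0 ≤ f) (ha : 0 ≤ a) :
    0 ≤ widePhiPoly (a + f + 13 / 4) ((a + 5) * (a + 2 * f + 3)) (a + 3) := by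
  have key : widePhiPoly (a + f + 13 / 4) ((a + 5) * (a + 2 * f + 3)) (a + 3) =
      (4845/8 : ℝ) + (13883/16 : ℝ) * a + (2495/4 : ℝ) * f + (1961/4 : ℝ) * a ^ 2 +
      (5013/8 : ℝ) * f * a + (520 : ℝ) * f ^ 2 + (2181/16 : ℝ) * a ^ 3 + (457/2 : ℝ) * f * a ^ 2 +
      (484 : ℝ) * f ^ 2 * a + (140 : ℝ) * f ^ 3 + (149/8 : ℝ) * a ^ 4 + (285/8 : ℝ) * f * a ^ 3 +
      (176 : ℝ) * f ^ 2 * a ^ 2 + (98 : ℝ) * f ^ 3 * a + (1 : ℝ) * a ^ 5 + (2 : ℝ) * f * a ^ 4 +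
      (30 : ℝ) * f ^ 2 * a ^ 3 + (24 : ℝ) * f ^ 3 * a ^ 2 + (2 : ℝ) * f ^ 2 * a ^ 4 +
      (2 : ℝ) * f ^ 3 * a ^ 3 := by
    unfold widePhiPoly; ring
  rw [key]; positivity

/-- Certificate B2 (`x = n − 2`): with `n = 4 + a`, `F = n − 3/4 + f` (`f, a ≥ 0`),
`Φ(F, (n+1)(2F−n+1/2), n − 2)` has non-negative coefficients in `f, a`. [folklore] -/
private theorem widePhiPoly_certB2 {f a : ℝ} (hf : 0 ≤ f) (ha : 0 ≤ a) :
    0 ≤ widePhiPoly (a + f + 13 / 4) ((a + 5) * (a + 2 * f + 3)) (a + 2) := by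
  have key : widePhiPoly (a + f + 13 / 4) ((a + 5) * (a + 2 * f + 3)) (a + 2) =
      (621 : ℝ) + (14277/16 : ℝ) * a + (641 : ℝ) * f + (4085/8 : ℝ) * a ^ 2 +
      (5245/8 : ℝ) * f * a + (304 : ℝ) * f ^ 2 + (2303/16 : ℝ) * a ^ 3 + (981/4 : ℝ) * f * a ^ 2 +
      (286 : ℝ) * f ^ 2 * a + (80 : ℝ) * f ^ 3 + (157/8 : ℝ) * a ^ 4 + (309/8 : ℝ) * f * a ^ 3 +
      (116 : ℝ) * f ^ 2 * a ^ 2 + (66 : ℝ) * f ^ 3 * a + (1 : ℝ) * a ^ 5 + (2 : ℝ) * f * a ^ 4 +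
      (24 : ℝ) * f ^ 2 * a ^ 3 + (20 : ℝ) * f ^ 3 * a ^ 2 + (2 : ℝ) * f ^ 2 * a ^ 4 +
      (2 : ℝ) * f ^ 3 * a ^ 3 := by
    unfold widePhiPoly; ring
  rw [key]; positivity

/-- `Φ(F, (n+1)(2F−n+1/2), x) ≥ 0` for `1 ≤ x ≤ n`, `n ≥ 4`, `F ≥ n − 3/4` (`x, n` real images of
naturals: `x + 3 ≤ n` or `x ∈ {n−2, n−1, n}`). [folklore] -/
private theorem widePhiPoly_top_nonneg {F m x : ℝ} (hx1 : 1 ≤ x) (hm : 4 ≤ m)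
    (hint : x + 3 ≤ m ∨ (x + 2 = m ∨ (x + 1 = m ∨ x = m))) (hF : m - 3 / 4 ≤ F) :
    0 ≤ widePhiPoly F ((m + 1) * (2 * F - m + 1 / 2)) x := by
  rcases hint with h | h | h | h
  · have hf : 0 ≤ F - m + 3 / 4 := by linarith
    have ha : 0 ≤ x - 1 := by linarith
    have hb : 0 ≤ m - 3 - x := by linarith
    have key := widePhiPoly_certA hf ha hb
    convert key using 2 <;> ring
  · have hf : 0 ≤ F - m + 3 / 4 := by linarith
    have ha : 0 ≤ m - 4 := by linarith
    have key := widePhiPoly_certB2 hf ha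
    convert key using 2 <;> linarith
  · have hf : 0 ≤ F - m + 3 / 4 := by linarith
    have ha : 0 ≤ m - 4 := by linarith
    have key := widePhiPoly_certB1 hf ha
    convert key using 2 <;> linarith
  · have hf : 0 ≤ F - m + 3 / 4 := by linarith
    have ha : 0 ≤ m - 4 := by linarith
    have key := widePhiPoly_certB0 hf ha
    convert key using 2 <;> linarith

/-- The cleared-denominator form of `κ_{n,x} ≤ F²/Q` in the wide regime: for `0 < Q ≤ (n+1)(2F−n+1/2)`
(i.e. `c ≥ −5/8`) and `F ≥ n − 3/4` (i.e. `Δ ≥ 1/2`), `n ≥ 4`,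
`((F² + x(x+1))(Q + x(x−1)) + 2x(F−x−1)²)·Q ≤ F²·(Q + (x+1)(x+2))(Q + x(x−1))`. [folklore] -/
private theorem wideKappa_core {F Q m x : ℝ} (hx1 : 1 ≤ x) (hm : 4 ≤ m)
    (hint : x + 3 ≤ m ∨ (x + 2 = m ∨ (x + 1 = m ∨ x = m))) (hQ0 : 0 < Q)
    (hQ : Q ≤ (m + 1) * (2 * F - m + 1 / 2)) (hF : m - 3 / 4 ≤ F) :
    ((F ^ 2 + x * (x + 1)) * (Q + x * (x - 1)) + 2 * x * (F - x - 1) ^ 2) * Q ≤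
      F ^ 2 * ((Q + (x + 1) * (x + 2)) * (Q + x * (x - 1))) := by
  have hΨ := widePhiPoly_top_nonneg hx1 hm hint hF
  have hQm : 0 < (m + 1) * (2 * F - m + 1 / 2) := lt_of_lt_of_le hQ0 hQ
  have hx0 : 0 ≤ x - 1 := by linarith
  have hγ : 0 ≤ x * (x + 1) * Q * ((m + 1) * (2 * F - m + 1 / 2)) +
      F ^ 2 * (x - 1) * x * (x + 1) * (x + 2) := by
    positivity
  have hmono : (m + 1) * (2 * F - m + 1 / 2) * widePhiPoly F Q x =
      Q * widePhiPoly F ((m + 1) * (2 * F - m + 1 / 2)) x +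
        ((m + 1) * (2 * F - m + 1 / 2) - Q) *
          (x * (x + 1) * Q * ((m + 1) * (2 * F - m + 1 / 2)) +
            F ^ 2 * (x - 1) * x * (x + 1) * (x + 2)) := by
    unfold widePhiPoly; ring
  have hΦ' : 0 ≤ (m + 1) * (2 * F - m + 1 / 2) * widePhiPoly F Q x := by
    rw [hmono]
    have : 0 ≤ (m + 1) * (2 * F - m + 1 / 2) - Q := sub_nonneg.2 hQ
    positivity
  have hΦ : 0 ≤ widePhiPoly F Q x := le_of_mul_le_mul_left (by rwa [mul_zero]) hQm
  have hid : F ^ 2 * ((Q + (x + 1) * (x + 2)) * (Q + x * (x - 1))) -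
      ((F ^ 2 + x * (x + 1)) * (Q + x * (x - 1)) + 2 * x * (F - x - 1) ^ 2) * Q = widePhiPoly F Q x := by
    unfold widePhiPoly; ring
  linarith [hΦ, hid]

/-! ### 2. The ratio bound and its consequences in the wide regime -/

/-- **Ratio bound, wide regime.** For a scalar exchange with `Δ ≥ 1/2` and `c ≥ −5/8`, every transfer
coefficient from level `n ≥ 4` is below the closed form: `κ_{n,i}(c; Δ) ≤ K_n(c; Δ)`, `0 ≤ i ≤ n`.
[cite: DolanOsborn2004, §3 eqs. (3.11)–(3.12)] -/
theorem diagKappa_le_diagRatioBound_wide {c Δ : ℝ} (hΔ : 1 / 2 ≤ Δ) (hc : -5 / 8 ≤ c) {n i : ℕ}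
    (hn : 4 ≤ n) (hi : i ≤ n) : diagKappa c Δ n i ≤ diagRatioBound c Δ n := by
  have hn' : (4 : ℝ) ≤ n := by exact_mod_cast hn
  have hi' : (i : ℝ) ≤ n := by exact_mod_cast hi
  unfold diagKappa diagRatioBound
  set F : ℝ := Δ + n + 2 * c with hF
  set Q : ℝ := ((n : ℝ) + 1) * (2 * Δ + n - 2) with hQ
  have hQpos : 0 < 2 * Δ + n - 2 := by linarith
  have hQ0 : 0 < Q := by positivity
  have hQle : Q ≤ ((n : ℝ) + 1) * (2 * F - n + 1 / 2) :=
    mul_le_mul_of_nonneg_left (by rw [hF]; linarith) (by positivity)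
  have hFge : (n : ℝ) - 3 / 4 ≤ F := by rw [hF]; linarith
  have hP1 : casimirPivot3D Δ 0 (n + 1) (i + 1) = Q + ((i : ℝ) + 1) * ((i : ℝ) + 2) := by
    unfold casimirPivot3D; push_cast; rw [hQ]; ring
  have hPp : 0 < Q + ((i : ℝ) + 1) * ((i : ℝ) + 2) := by positivity
  rcases Nat.eq_zero_or_pos i with rfl | hi1
  · simp only [hrGammaMinusAB_zero, zero_div, add_zero]
    rw [hP1]
    have hγ : hrGammaPlusAB c c (Δ + n) 0 = F ^ 2 := by
      unfold hrGammaPlusAB; push_cast; rw [hF]; ring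
    rw [hγ]
    push_cast
    exact div_le_div_of_nonneg_left (sq_nonneg F) hQ0 (by nlinarith)
  · have hx1 : (1 : ℝ) ≤ i := by exact_mod_cast hi1
    have hP2 : casimirPivot3D Δ 0 (n + 1) (i - 1) = Q + (i : ℝ) * ((i : ℝ) - 1) := by
      unfold casimirPivot3D; rw [Nat.cast_sub hi1]; push_cast; rw [hQ]; ring
    have hii : 0 ≤ (i : ℝ) * ((i : ℝ) - 1) := mul_nonneg (by positivity) (by linarith)
    have hPm : 0 < Q + (i : ℝ) * ((i : ℝ) - 1) := by linarith
    have hγp : hrGammaPlusAB c c (Δ + n) i = (F + i) ^ 2 * ((i : ℝ) + 1) / (2 * i + 1) := by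
      unfold hrGammaPlusAB; rw [hF]; ring
    have hγm : hrGammaMinusAB c c (Δ + n) i = (F - i - 1) ^ 2 * (i : ℝ) / (2 * i + 1) := by
      unfold hrGammaMinusAB; rw [hF]; ring
    rw [hP1, hP2, hγp, hγm, div_add_div _ _ hPp.ne' hPm.ne', div_le_div_iff₀ (mul_pos hPp hPm) hQ0]
    have h2i : (2 : ℝ) * i + 1 ≠ 0 := by positivity
    have hsum : (F + i) ^ 2 * ((i : ℝ) + 1) / (2 * i + 1) * (Q + (i : ℝ) * ((i : ℝ) - 1)) +
        (Q + ((i : ℝ) + 1) * ((i : ℝ) + 2)) * ((F - i - 1) ^ 2 * (i : ℝ) / (2 * i + 1)) =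
        (F ^ 2 + i * (i + 1)) * (Q + i * (i - 1)) + 2 * i * (F - i - 1) ^ 2 := by
      field_simp; ring
    rw [hsum]
    have hint : (i : ℝ) + 3 ≤ n ∨ ((i : ℝ) + 2 = n ∨ ((i : ℝ) + 1 = n ∨ (i : ℝ) = n)) := by
      rcases Nat.lt_or_ge (i + 2) n with h | h
      · left; exact_mod_cast Nat.succ_le_of_lt h
      · right
        rcases Nat.lt_or_ge (i + 1) n with h1 | h1
        · left; exact_mod_cast le_antisymm (Nat.succ_le_of_lt h1) h
        · right
          rcases Nat.lt_or_ge i n with h2 | h2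
          · left; exact_mod_cast le_antisymm (Nat.succ_le_of_lt h2) h1
          · right; exact_mod_cast le_antisymm hi h2
    exact wideKappa_core hx1 hn' hint hQ0 hQle hFge

/-- **Level-sum ratio bound, wide regime**: `a_{n+1}(c,c) ≤ K_n(c; Δ)·a_n(c,c)` for a scalar exchange
above the bound, `c ≥ −5/8`, `n ≥ 4`. [cite: DolanOsborn2004, §3 eqs. (3.11)–(3.12)] -/
theorem hrLevelSumAB_self_succ_le_wide {c Δ : ℝ} (hΔ : unitarityBound3D 0 < Δ) (hc : -5 / 8 ≤ c)
    {n : ℕ} (hn : 4 ≤ n) :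
    hrLevelSumAB c c Δ 0 (n + 1) ≤ diagRatioBound c Δ n * hrLevelSumAB c c Δ 0 n := by
  have hhalf : 1 / 2 < Δ := one_half_lt_of_unitarityBound3D_lt hΔ
  rw [hrLevelSumAB_self_succ_eq c Δ n]
  unfold hrLevelSumAB
  rw [zero_add, mul_sum]
  refine sum_le_sum fun i hi => ?_
  have hin : i ≤ n := by have := mem_range.1 hi; omega
  exact mul_le_mul_of_nonneg_right (diagKappa_le_diagRatioBound_wide hhalf.le hc hn hin)
    (hrCoeffAB_self_nonneg c hΔ n i)

/-- The same for the diagonal coefficients: `a_{n+1} ≤ K_n a_n` (`c ≥ −5/8`, `n ≥ 4`).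
[cite: DolanOsborn2004, §3 eqs. (3.11)–(3.12)] -/
theorem hrDiagCoeffAB_self_succ_le_wide {c Δ : ℝ} (hΔ : unitarityBound3D 0 < Δ) (hc : -5 / 8 ≤ c)
    {n : ℕ} (hn : 4 ≤ n) :
    hrDiagCoeffAB c c Δ 0 (n + 1) ≤ diagRatioBound c Δ n * hrDiagCoeffAB c c Δ 0 n := by
  unfold hrDiagCoeffAB
  rw [legendreLam_zero, div_one, div_one]
  exact hrLevelSumAB_self_succ_le_wide hΔ hc hn

/-- **Geometric growth from level `N ≥ 4`, wide regime**: under domination, `a_{N+m}(c,c) ≤ q^m a_N(c,c)`.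
[cite: DolanOsborn2004, §3 eqs. (3.11)–(3.12)] -/
theorem hrDiagCoeffAB_self_add_le_pow_wide {c Δ : ℝ} (hΔ : unitarityBound3D 0 < Δ) (hc : -5 / 8 ≤ c)
    {N : ℕ} (hN : 4 ≤ N) {q : ℝ} (hq : DiagRatioDom c Δ N q) (m : ℕ) :
    hrDiagCoeffAB c c Δ 0 (N + m) ≤ q ^ m * hrDiagCoeffAB c c Δ 0 N := by
  have hhalf : 1 / 2 < Δ := one_half_lt_of_unitarityBound3D_lt hΔ
  induction m with
  | zero => simp
  | succ m ih =>
    have hK := hq (N + m) (by omega)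
    have hq0 : 0 ≤ q := le_trans (diagRatioBound_nonneg hhalf (by omega)) hK
    have ha : 0 ≤ hrDiagCoeffAB c c Δ 0 (N + m) := hrDiagCoeffAB_self_nonneg c hΔ _
    calc hrDiagCoeffAB c c Δ 0 (N + m + 1)
        ≤ diagRatioBound c Δ (N + m) * hrDiagCoeffAB c c Δ 0 (N + m) :=
          hrDiagCoeffAB_self_succ_le_wide hΔ hc (by omega)
      _ ≤ q * (q ^ m * hrDiagCoeffAB c c Δ 0 N) := mul_le_mul hK ih ha hq0
      _ = q ^ (m + 1) * hrDiagCoeffAB c c Δ 0 N := by ring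

/-- **Domination uniformly on a parameter box, sign-condition form.** If `Δ₁ + N + 2c₁ ≥ 0` (so that
`(Δ+k+2c)²` is monotone in `c` on the box for `k ≥ N`), the corner tests at `(Δ₁, c₂)` and `(Δ₂, c₂)`
(with `q ≥ 1`, `N ≥ 2`, `Δ₁ > 1/2`) give `K_k(c; Δ) ≤ q` for all `k ≥ N` and every
`(Δ, c) ∈ [Δ₁, Δ₂] × [c₁, c₂]` — no lower bound on `c₁` beyond the sign condition.
[cite: DolanOsborn2004, §3 eqs. (3.11)–(3.12)] [cite: Moore1979, §2.2 eq. (2.19), §2.4] -/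
theorem diagRatioDom_on_box_of_nonneg {c₁ c₂ Δ₁ Δ₂ q : ℝ} {N : ℕ} (hΔ₁ : 1 / 2 < Δ₁) (h12 : Δ₁ ≤ Δ₂)
    (hsgn : 0 ≤ Δ₁ + N + 2 * c₁) (hN : 2 ≤ N) (h1 : 1 ≤ q) (htA : DiagRatioTest c₂ Δ₁ N q)
    (htB : DiagRatioTest c₂ Δ₂ N q) {Δ c : ℝ} (hΔl : Δ₁ ≤ Δ) (hΔu : Δ ≤ Δ₂) (hcl : c₁ ≤ c)
    (hcu : c ≤ c₂) : DiagRatioDom c Δ N q := by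
  intro k hk
  have dA := diagRatioDom_of_test hΔ₁ hN h1 htA k hk
  have dB := diagRatioDom_of_test (lt_of_lt_of_le hΔ₁ h12) hN h1 htB k hk
  unfold diagRatioBound at dA dB ⊢
  have hk' : (N : ℝ) ≤ k := by exact_mod_cast hk
  have hN' : (2 : ℝ) ≤ N := by exact_mod_cast hN
  have hposA : 0 < 2 * Δ₁ + k - 2 := by linarith
  have hposB : 0 < 2 * Δ₂ + k - 2 := by linarith
  have hpos : 0 < 2 * Δ + k - 2 := by linarith
  have hdenA : 0 < ((k : ℝ) + 1) * (2 * Δ₁ + k - 2) := by positivity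
  have hdenB : 0 < ((k : ℝ) + 1) * (2 * Δ₂ + k - 2) := by positivity
  have hden : 0 < ((k : ℝ) + 1) * (2 * Δ + k - 2) := by positivity
  rw [div_le_iff₀ hdenA] at dA
  rw [div_le_iff₀ hdenB] at dB
  rw [div_le_iff₀ hden]
  have hF0 : 0 ≤ Δ + k + 2 * c := by linarith
  have hsq : (Δ + k + 2 * c) ^ 2 ≤ (Δ + k + 2 * c₂) ^ 2 := by
    apply sq_le_sq'
    · linarith
    · linarith
  have key : (Δ₂ - Δ₁) * (q * (((k : ℝ) + 1) * (2 * Δ + k - 2)) - (Δ + k + 2 * c₂) ^ 2) =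
      (Δ₂ - Δ) * (q * (((k : ℝ) + 1) * (2 * Δ₁ + k - 2)) - (Δ₁ + k + 2 * c₂) ^ 2) +
        (Δ - Δ₁) * (q * (((k : ℝ) + 1) * (2 * Δ₂ + k - 2)) - (Δ₂ + k + 2 * c₂) ^ 2) +
          (Δ₂ - Δ₁) * ((Δ - Δ₁) * (Δ₂ - Δ)) := by
    ring
  rcases eq_or_lt_of_le h12 with heq | hlt
  · have hΔe : Δ = Δ₁ := le_antisymm (hΔu.trans heq.ge) hΔl
    subst hΔe
    linarith
  · have t1 : 0 ≤ (Δ₂ - Δ) * (q * (((k : ℝ) + 1) * (2 * Δ₁ + k - 2)) - (Δ₁ + k + 2 * c₂) ^ 2) :=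
      mul_nonneg (by linarith) (by linarith)
    have t2 : 0 ≤ (Δ - Δ₁) * (q * (((k : ℝ) + 1) * (2 * Δ₂ + k - 2)) - (Δ₂ + k + 2 * c₂) ^ 2) :=
      mul_nonneg (by linarith) (by linarith)
    have t3 : 0 ≤ (Δ₂ - Δ₁) * ((Δ - Δ₁) * (Δ₂ - Δ)) :=
      mul_nonneg (by linarith) (mul_nonneg (by linarith) (by linarith))
    have hprod : 0 ≤ (Δ₂ - Δ₁) * (q * (((k : ℝ) + 1) * (2 * Δ + k - 2)) - (Δ + k + 2 * c₂) ^ 2) := by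
      rw [key]; linarith
    have hmain : 0 ≤ q * (((k : ℝ) + 1) * (2 * Δ + k - 2)) - (Δ + k + 2 * c₂) ^ 2 :=
      le_of_mul_le_mul_left (by rwa [mul_zero]) (sub_pos.2 hlt)
    linarith

/-- **Geometric tail bound, wide regime** (`c ≥ −5/8`, `N ≥ 3`, `0 < y < 1`, `q y < 1`, domination from
level `N + 1`): `𝒯_N(c; y) ≤ a_{N+1}(c,c) y^{Δ+N+1}/(1 − q y)`.
[cite: DolanOsborn2004, §3 eqs. (3.11)–(3.12)] -/
theorem diagTailAB_le_geom_wide {c Δ : ℝ} (hΔ : unitarityBound3D 0 < Δ) (hc : -5 / 8 ≤ c) {N : ℕ}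
    (hN : 3 ≤ N) {q y : ℝ} (hy0 : 0 < y) (hy1 : y < 1) (hqy : q * y < 1)
    (hdom : DiagRatioDom c Δ (N + 1) q) :
    diagTailAB c Δ 0 N y ≤ hrDiagCoeffAB c c Δ 0 (N + 1) * y ^ (Δ + N + 1) / (1 - q * y) := by
  have hhalf : 1 / 2 < Δ := one_half_lt_of_unitarityBound3D_lt hΔ
  have hq0 : 0 ≤ q :=
    le_trans (diagRatioBound_nonneg hhalf (by omega : 2 ≤ N + 1)) (hdom (N + 1) le_rfl)
  have hqy0 : 0 ≤ q * y := mul_nonneg hq0 hy0.le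
  have hterm : ∀ m : ℕ, hrDiagCoeffAB c c Δ 0 (m + (N + 1)) * y ^ ((Δ + N + 1) + (m : ℝ)) ≤
      hrDiagCoeffAB c c Δ 0 (N + 1) * y ^ (Δ + N + 1) * (q * y) ^ m := by
    intro m
    rw [Real.rpow_add hy0, Real.rpow_natCast, mul_pow, add_comm m (N + 1)]
    have h1 := hrDiagCoeffAB_self_add_le_pow_wide hΔ hc (by omega : 4 ≤ N + 1) hdom m
    have hw : 0 ≤ y ^ (Δ + N + 1) * y ^ m := by positivity
    calc hrDiagCoeffAB c c Δ 0 (N + 1 + m) * (y ^ (Δ + N + 1) * y ^ m)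
        ≤ q ^ m * hrDiagCoeffAB c c Δ 0 (N + 1) * (y ^ (Δ + N + 1) * y ^ m) :=
          mul_le_mul_of_nonneg_right h1 hw
      _ = hrDiagCoeffAB c c Δ 0 (N + 1) * y ^ (Δ + N + 1) * (q ^ m * y ^ m) := by ring
  have hsL := summable_diagTailAB c hΔ ⟨hy0, hy1⟩ N
  have hsR : Summable fun m : ℕ => hrDiagCoeffAB c c Δ 0 (N + 1) * y ^ (Δ + N + 1) * (q * y) ^ m :=
    (summable_geometric_of_lt_one hqy0 hqy).mul_left _
  calc diagTailAB c Δ 0 N y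
      = ∑' m : ℕ, hrDiagCoeffAB c c Δ 0 (m + (N + 1)) * y ^ ((Δ + N + 1) + (m : ℝ)) := rfl
    _ ≤ ∑' m : ℕ, hrDiagCoeffAB c c Δ 0 (N + 1) * y ^ (Δ + N + 1) * (q * y) ^ m :=
        Summable.tsum_le_tsum hterm hsL hsR
    _ = hrDiagCoeffAB c c Δ 0 (N + 1) * y ^ (Δ + N + 1) * ∑' m : ℕ, (q * y) ^ m := tsum_mul_left
    _ = hrDiagCoeffAB c c Δ 0 (N + 1) * y ^ (Δ + N + 1) / (1 - q * y) := by
        rw [tsum_geometric_of_lt_one hqy0 hqy, div_eq_mul_inv]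

/-- **Closed-form majorant of the diagonal series, wide regime**:
`D(c; y) ≤ S_N(c; y) + a_{N+1}(c,c) y^{Δ+N+1}/(1 − q y)` (`c ≥ −5/8`, `N ≥ 3`).
[cite: DolanOsborn2004, §3 eqs. (3.11)–(3.12)] -/
theorem diagSeriesAB_le_head_add_geom_wide {c Δ : ℝ} (hΔ : unitarityBound3D 0 < Δ) (hc : -5 / 8 ≤ c)
    {N : ℕ} (hN : 3 ≤ N) {q y : ℝ} (hy0 : 0 < y) (hy1 : y < 1) (hqy : q * y < 1)
    (hdom : DiagRatioDom c Δ (N + 1) q) :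
    diagSeriesAB c Δ 0 y ≤
      hrDiagPartialSumAB c c Δ 0 N y + hrDiagCoeffAB c c Δ 0 (N + 1) * y ^ (Δ + N + 1) / (1 - q * y) := by
  rw [diagSeriesAB_eq_partialSum_add_tail c hΔ ⟨hy0, hy1⟩ N]
  exact add_le_add le_rfl (diagTailAB_le_geom_wide hΔ hc hN hy0 hy1 hqy hdom)

/-- The same with the finite test in place of domination (`q ≥ 1`).
[cite: DolanOsborn2004, §3 eqs. (3.11)–(3.12)] -/
theorem diagSeriesAB_le_head_add_geom_of_test_wide {c Δ : ℝ} (hΔ : unitarityBound3D 0 < Δ)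
    (hc : -5 / 8 ≤ c) {N : ℕ} (hN : 3 ≤ N) {q y : ℝ} (hy0 : 0 < y) (hy1 : y < 1) (h1 : 1 ≤ q)
    (hqy : q * y < 1) (ht : DiagRatioTest c Δ (N + 1) q) :
    diagSeriesAB c Δ 0 y ≤
      hrDiagPartialSumAB c c Δ 0 N y + hrDiagCoeffAB c c Δ 0 (N + 1) * y ^ (Δ + N + 1) / (1 - q * y) :=
  diagSeriesAB_le_head_add_geom_wide hΔ hc hN hy0 hy1 hqy
    (diagRatioDom_of_test (one_half_lt_of_unitarityBound3D_lt hΔ) (by omega) h1 ht)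

/-- **One closed-form number per box, wide regime.** For every `(Δ, c) ∈ [Δ₁, Δ₂] × [c₁, c₂]` (`Δ₁ > 1/2`
the scalar bound, `c₁ ≥ −5/8`), `0 < y < 1`, `q ≥ 1` with `q y < 1` passing the test at the corners
`(Δ₁, c₂)` and `(Δ₂, c₂)` at level `N + 1` (`N ≥ 3`): `D(c; y) ≤ diagBoxBound c₁ c₂ Δ₁ Δ₂ N q y`.
[cite: DolanOsborn2004, §3 eqs. (3.11)–(3.12)] [cite: Moore1979, §2.2 eq. (2.19), §2.4] -/
theorem diagSeriesAB_le_boxBound_wide {c₁ c c₂ Δ₁ Δ Δ₂ q y : ℝ} {N : ℕ}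
    (hΔ₁ : unitarityBound3D 0 < Δ₁) (hΔl : Δ₁ ≤ Δ) (hΔu : Δ ≤ Δ₂) (hc₁ : -5 / 8 ≤ c₁) (hcl : c₁ ≤ c)
    (hcu : c ≤ c₂) (hN : 3 ≤ N) (hy0 : 0 < y) (hy1 : y < 1) (h1 : 1 ≤ q) (hqy : q * y < 1)
    (htA : DiagRatioTest c₂ Δ₁ (N + 1) q) (htB : DiagRatioTest c₂ Δ₂ (N + 1) q) :
    diagSeriesAB c Δ 0 y ≤ diagBoxBound c₁ c₂ Δ₁ Δ₂ N q y := by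
  have hhalf₁ : 1 / 2 < Δ₁ := one_half_lt_of_unitarityBound3D_lt hΔ₁
  have hΔ : unitarityBound3D 0 < Δ := lt_of_lt_of_le hΔ₁ hΔl
  have hc : -5 / 8 ≤ c := le_trans hc₁ hcl
  have hN' : (3 : ℝ) ≤ N := by exact_mod_cast hN
  have hsgn : 0 ≤ Δ₁ + ((N + 1 : ℕ) : ℝ) + 2 * c₁ := by push_cast; linarith
  have hdom : DiagRatioDom c Δ (N + 1) q :=
    diagRatioDom_on_box_of_nonneg hhalf₁ (hΔl.trans hΔu) hsgn (by omega) h1 htA htB hΔl hΔu hcl hcu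
  have hmain := diagSeriesAB_le_head_add_geom_wide hΔ hc hN hy0 hy1 hqy hdom
  have hq0 : 0 ≤ q * y := mul_nonneg (by linarith) hy0.le
  have hgeo : 0 < 1 - q * y := by linarith
  have hlev : ∀ n : ℕ, hrDiagCoeffAB c c Δ 0 n * y ^ (Δ + n) ≤
      diagLevelBoxBound c₁ c₂ Δ₁ Δ₂ n * y ^ (Δ₁ + n) := fun n => by
    have ha := hrDiagCoeffAB_self_nonneg c hΔ n
    have hb := hrDiagCoeffAB_self_le_levelBoxBound hΔ₁ hΔl hΔu hcl hcu n
    have hpow : y ^ (Δ + n) ≤ y ^ (Δ₁ + n) :=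
      Real.rpow_le_rpow_of_exponent_ge hy0 hy1.le (by linarith)
    exact mul_le_mul hb hpow (Real.rpow_nonneg hy0.le _) (ha.trans hb)
  have hhead : hrDiagPartialSumAB c c Δ 0 N y ≤
      ∑ n ∈ range (N + 1), diagLevelBoxBound c₁ c₂ Δ₁ Δ₂ n * y ^ (Δ₁ + n) := by
    unfold hrDiagPartialSumAB
    exact sum_le_sum fun n _ => hlev n
  have htail : hrDiagCoeffAB c c Δ 0 (N + 1) * y ^ (Δ + N + 1) / (1 - q * y) ≤
      diagLevelBoxBound c₁ c₂ Δ₁ Δ₂ (N + 1) * y ^ (Δ₁ + N + 1) / (1 - q * y) := by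
    apply div_le_div_of_nonneg_right _ hgeo.le
    have h := hlev (N + 1)
    push_cast at h
    rw [show Δ + N + 1 = Δ + ((N : ℝ) + 1) by ring, show Δ₁ + N + 1 = Δ₁ + ((N : ℝ) + 1) by ring]
    exact h
  unfold diagBoxBound
  linarith [hmain, hhead, htail]

end Literature.MathematicalPhysics.QuantumFieldTheory.ConformalBootstrap3D

end
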